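import Summits.BirchSwinnertonDyer.BirchSwinnertonDyer.Theses.UniversalToricDescent
import Summits.BirchSwinnertonDyer.BirchSwinnertonDyer.Theorems.UniversalToricDescentTwinSplitIMCAtThreeGoodSSApZeroHalves
import Summits.BirchSwinnertonDyer.BirchSwinnertonDyer.Theorems.UniversalToricDescentTwinSplitIMCAtThreeMultHalves
import HarnessLib

/-!
# Route `UniversalToricDescent`, act D (rev 34–40): the ♭ twin cruxes BY NAME from the banked twin-IMC cruxes —
# `TwinWanFrameAtThreeGoodSSApZero` (♭C₀, stmt-BirchSwinnertonDyer-26063) ⟸ `TwinSplitIMCAtThreeGoodSSApZero` (23594),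
# `TwinWanFrameAtThreeMult` (♭B, stmt-BirchSwinnertonDyer-26062) ⟸ `TwinSplitIMCAtThreeMult` (20694), and the package

Cell `bsd-wall` (run/shared/lean/pub/bsd-wall/), width seat `bsd-wall-utd-p2-w2` (prover g2, 2026-08-28), on the UTD
pen's act-D staffing note (ii) (STATUS 2026-08-28T06:28:44Z): «their 23594/20694 lines close the ♭ items by monotonicity —
land as `--supports 26063/26062`». `--supports stmt-BirchSwinnertonDyer-26063 --as helper`.

## What this file proves (bookkeeping only; numbers, not adjectives)

Act D (route revs 37–38) split the one-sided twin package `TwinWanFrameAtThreeNonOrdBuckets` (item 25912) into the two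
♭ cruxes ♭B `TwinWanFrameAtThreeMult` (26062) and ♭C₀ `TwinWanFrameAtThreeGoodSSApZero` (26063), whose texts are, verbatim
and fully qualified, the registered Wan-frame stubs `stub_wanFrameMult` (line `threeframes` on 20694) and
`stub_wanFrameSS_apZero` (line `threeframes_apzero` on 23594). The LEAD g10's lossless-split certificates
`wanHalf_of_twinSplitIMCAtThreeGoodSSApZero` (p600739) and `wanHalf_of_twinSplitIMCAtThreeMult` (p606975) prove those stub
texts from the banked twin-IMC cruxes (`k = 0` serves). This file restates them ON THE ROUTE DECLS, so that the d0 cone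
records the implications by name:

* `twinWanFrameAtThreeGoodSSApZero_of_twinSplitIMCAtThreeGoodSSApZero : TwinSplitIMCAtThreeGoodSSApZero → TwinWanFrameAtThreeGoodSSApZero`;
* `twinWanFrameAtThreeMult_of_twinSplitIMCAtThreeMult : TwinSplitIMCAtThreeMult → TwinWanFrameAtThreeMult`;
* `twinWanFrameAtThreeNonOrdBuckets_of_twinSplitIMCAtThreeMult_of_twinSplitIMCAtThreeGoodSSApZero` — the package (25912)
  from the two banked cruxes (through the landed glue shape `⟨·, ·⟩`, item 26064 ✓);
* `twinWanFrameAtThreeNonOrdBuckets_of_twinSplitIMCAtThreeNonOrdBuckets` — the package from the banked twin-IMC PACKAGE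
  `TwinSplitIMCAtThreeNonOrdBuckets` (24909, aside), i.e. the monotonicity «24909 ⟹ 25912» quoted in 25912's docstring.

HONEST FRAMING: one-line theorems over p600739/p606975 (definitional unfolding of the route decls); every crux is a
displayed hypothesis; nothing here proves an instance of any frame; no item is closed by this file; BSD is not proved for
any curve. No definition, no named fact, no `sorry`. Beyond-print theorem: NO.

References: route file `Theses/UniversalToricDescent.lean` rev 40 (items 24909, 25912, 26062, 26063, 26064);
[Castella2018] Thm. 3.1 (the frame predicate `IsBDPLFunction`); vet certificate Combined_actD_g7.lean l.989–997
(bsd-vet-tk5d g7, the same two monotonicities checked outside the tree).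
-/

noncomputable section

open scoped Classical

set_option linter.dupNamespace false
set_option autoImplicit false

namespace Summit.BirchSwinnertonDyer.BirchSwinnertonDyer.Theorems.UniversalToricDescentActDMonotonicity

open Summit.BirchSwinnertonDyer.BirchSwinnertonDyer.Theses.UniversalToricDescent
  Summit.BirchSwinnertonDyer.BirchSwinnertonDyer.Theorems.UniversalToricDescentTwinSplit

/-- **♭C₀ ⟸ crux C₀, BY NAME**: the act-D crux `TwinWanFrameAtThreeGoodSSApZero` (stmt-BirchSwinnertonDyer-26063: ONE BDP
frame with the rational Wan/Eisenstein clause at every datum of a good-supersingular `a₃ = 0` twin) follows from the banked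
twin-IMC crux `TwinSplitIMCAtThreeGoodSSApZero` (stmt-BirchSwinnertonDyer-23594: a frame exists and `Ch·R₀⟦T⟧ = (L′)` at
every frame) — clause (ii) at the frame of clause (i) gives the Wan clause with `k = 0`
(`wanHalf_of_twinSplitIMCAtThreeGoodSSApZero`, p600739). The ♭C₀ text is the registered stub `stub_wanFrameSS_apZero` of
line `threeframes_apzero`, fully qualified. [cite: Castella2018, Thm. 3.1 (arXiv:1704.06608 p. 9) (the frame predicate)] -/
theorem twinWanFrameAtThreeGoodSSApZero_of_twinSplitIMCAtThreeGoodSSApZero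
    (h : TwinSplitIMCAtThreeGoodSSApZero) : TwinWanFrameAtThreeGoodSSApZero := by
  unfold TwinWanFrameAtThreeGoodSSApZero
  exact wanHalf_of_twinSplitIMCAtThreeGoodSSApZero h

/-- **♭B ⟸ crux B, BY NAME**: the act-D crux `TwinWanFrameAtThreeMult` (stmt-BirchSwinnertonDyer-26062: ONE BDP frame
with the rational Wan/Eisenstein clause at every datum of a multiplicative-at-3 twin) follows from the banked twin-IMC crux
`TwinSplitIMCAtThreeMult` (stmt-BirchSwinnertonDyer-20694), by `wanHalf_of_twinSplitIMCAtThreeMult` (p606975, `k = 0`).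
The ♭B text is the registered stub `stub_wanFrameMult` of line `threeframes` (v3), fully qualified.
[cite: Castella2018, Thm. 3.1 (arXiv:1704.06608 p. 9) (the frame predicate)] -/
theorem twinWanFrameAtThreeMult_of_twinSplitIMCAtThreeMult
    (h : TwinSplitIMCAtThreeMult) : TwinWanFrameAtThreeMult := by
  unfold TwinWanFrameAtThreeMult
  exact wanHalf_of_twinSplitIMCAtThreeMult h

/-- **The ♭ package ⟸ the two banked twin-IMC cruxes**: `TwinWanFrameAtThreeNonOrdBuckets` (item 25912, the binder
`h3` of the act-D `closes`) is the conjunction ♭B ∧ ♭C₀ (defeq; generated glue 26064 = `⟨·, ·⟩`), so it follows from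
`TwinSplitIMCAtThreeMult` (20694) and `TwinSplitIMCAtThreeGoodSSApZero` (23594). [folklore] -/
theorem twinWanFrameAtThreeNonOrdBuckets_of_twinSplitIMCAtThreeMult_of_twinSplitIMCAtThreeGoodSSApZero
    (hB : TwinSplitIMCAtThreeMult) (hC : TwinSplitIMCAtThreeGoodSSApZero) : TwinWanFrameAtThreeNonOrdBuckets :=
  ⟨twinWanFrameAtThreeMult_of_twinSplitIMCAtThreeMult hB,
    twinWanFrameAtThreeGoodSSApZero_of_twinSplitIMCAtThreeGoodSSApZero hC⟩

/-- **The ♭ package ⟸ the banked twin-IMC package** («strictly WEAKER than 24909», the monotonicity quoted in item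
25912's docstring): `TwinSplitIMCAtThreeNonOrdBuckets` (item 24909, aside since act D2; defeq the conjunction
20694 ∧ 23594) implies `TwinWanFrameAtThreeNonOrdBuckets` (item 25912). [folklore] -/
theorem twinWanFrameAtThreeNonOrdBuckets_of_twinSplitIMCAtThreeNonOrdBuckets
    (h : TwinSplitIMCAtThreeNonOrdBuckets) : TwinWanFrameAtThreeNonOrdBuckets :=
  twinWanFrameAtThreeNonOrdBuckets_of_twinSplitIMCAtThreeMult_of_twinSplitIMCAtThreeGoodSSApZero h.1 h.2

end Summit.BirchSwinnertonDyer.BirchSwinnertonDyer.Theorems.UniversalToricDescentActDMonotonicity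

end
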